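import Mathlib
import Summits.AtomisticToContinuum.HydrodynamicLimit.Theorems.InformationPercolationEngineKickFairRelEquilibriumMesoDefs
import Summits.AtomisticToContinuum.HydrodynamicLimit.Theorems.InformationPercolationEngineKickFairRelEquilibriumMesoTransferEnum
import Summits.AtomisticToContinuum.HydrodynamicLimit.Theorems.InformationPercolationEngineKickFairRelEquilibriumMesoTransferSlots
import HarnessLib

/-!
# `KickFairRelEquilibriumMeso`, line `Sketch` — stub G1 `stub_cutCount`: at most `A + 1` long-flight
# collisions per sphere per kinetic window

Prover file (`--supports stmt-AtomisticToContinuum-15177`) for the registered stub `stub_cutCount` of the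
skeleton `Cruxes/KickFairRelEquilibriumMeso/Lines/Sketch.lean` (rev 7). Rev 7 of the line CUTS short free
flights: the weights of the kick sum vanish on collisions of sphere `i` preceded by a flight of `i` shorter
than `t_N / A`. This file is the combinatorial heart of why the cut kick sum is bounded: in a window
`(t₁, t₂]` of length `≤ t_N`, sphere `i` has at most `A + 1` collisions whose preceding flight is `≥ t_N / A`.

Proof. Fix a good initial datum `z` and a sphere `i`; let `S` be the set of collision times of `i` along the
orbit and `t n = Φ.nthCollisionTimeOf i n z = nthTimeAfter S 0 n`. For `n < cnt = ncard (S ∩ (0, τ])` the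
time `t n` lies in `S ∩ (0, τ]` and `n ↦ t n` is strictly increasing there (`transferEnum`,
`strictMonoOn_nthTimeAfter_of_ncard`); the orbit is a hard-sphere trajectory, so the collision times of `i`
in `(0, t n)` are finitely many and the flight start `s n = flightStart … 0 i (t n)` (an `sSup`) dominates
`t (n-1)` for `1 ≤ n < cnt` (`le_flightStart_of_mem`). Hence the flight length `t n − s n` is at most the gap
`t n − t (n-1)`. Let `J` be the set of indices `n < cnt` with `t₁ < t n ≤ t₂` and flight `≥ L := t_N / A`
(the summand is the indicator of `J`). If `J ≠ ∅`, let `n₀ = min J`, `m = max J`; for `n ∈ J ∖ {n₀}` the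
gap `t n − t (n-1)` is `≥ L`, and these gaps are among the (nonnegative) gaps telescoping over
`n ∈ (n₀, m]` to `t m − t n₀ ≤ t₂ − t₁ ≤ t_N`; so `(#J − 1) L ≤ t_N`, i.e. `#J ≤ A + 1`. The abstract
counting step is `sum_indicator_longFlight_le` (any real sequences `t`, `fs`); the stub applies it on the
good set after unfolding the typed past (`(past …).2.2.2 = t n`, `(past …).2.1 = s n`).
-/

noncomputable section

open MeasureTheory Set Filter Topology
open scoped ENNReal Classical

namespace Summit.AtomisticToContinuum.HydrodynamicLimit.Theorems.KickFairRelEquilibriumMesoLine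

open Literature.Analysis.FluidPDE Literature.MathematicalPhysics.KineticTheory

/-! ## The abstract counting step -/

/-- Telescoping over a discrete interval: `Σ_{n ∈ (a, b]} (t n − t (n−1)) = t b − t a` for `a ≤ b`.
[folklore] -/
theorem sum_Ioc_sub_pred_eq (t : ℕ → ℝ) {a b : ℕ} (hab : a ≤ b) :
    ∑ n ∈ Finset.Ioc a b, (t n - t (n - 1)) = t b - t a := by
  induction b, hab using Nat.le_induction with
  | base => simp
  | succ b hab ih =>
    rw [Finset.sum_Ioc_succ_top hab, ih, Nat.add_sub_cancel]
    ring

/-- **The counting step.** Let `t, fs : ℕ → ℝ` with `t` strictly increasing on `{n | n < c}` and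
`t (n−1) ≤ fs n` for `1 ≤ n < c` (the flight ending at `t n` starts after the previous collision), and let
`(t₁, t₂]` be a window of length `≤ T`, `A, T > 0`. Then the number of `n < c` with `t n ∈ (t₁, t₂]` and
flight `t n − fs n ≥ T / A` is at most `A + 1` (written as the sum of the product of the two indicators):
all but the first such `n` have gap `t n − t (n−1) ≥ T / A`, and the gaps over consecutive indices between the
first and the last telescope to at most `t₂ − t₁ ≤ T`. [folklore] -/
theorem sum_indicator_longFlight_le {t fs : ℕ → ℝ} {c : ℕ} {t₁ t₂ T A : ℝ} (hA : 0 < A) (hT : 0 < T)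
    (hmono : ∀ ⦃a b : ℕ⦄, a < c → b < c → a < b → t a < t b)
    (hfs : ∀ n, 1 ≤ n → n < c → t (n - 1) ≤ fs n) (ht₂ : t₂ ≤ t₁ + T) :
    ∑ n ∈ Finset.range c, ((if t₁ < t n ∧ t n ≤ t₂ then (1 : ℝ) else 0) *
        (if T / A ≤ t n - fs n then (1 : ℝ) else 0)) ≤ A + 1 := by
  set L : ℝ := T / A with hL
  have hL0 : 0 < L := div_pos hT hA
  set J : Finset ℕ := (Finset.range c).filter (fun n => (t₁ < t n ∧ t n ≤ t₂) ∧ L ≤ t n - fs n) with hJ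
  -- the sum is the cardinality of `J`
  have hsum : ∑ n ∈ Finset.range c, ((if t₁ < t n ∧ t n ≤ t₂ then (1 : ℝ) else 0) *
      (if L ≤ t n - fs n then (1 : ℝ) else 0)) = (J.card : ℝ) := by
    rw [hJ, Finset.natCast_card_filter]
    refine Finset.sum_congr rfl fun n _ => ?_
    rw [ite_zero_mul_ite_zero, one_mul]
  rw [hsum]
  have hmemJ : ∀ {n : ℕ}, n ∈ J → n < c ∧ (t₁ < t n ∧ t n ≤ t₂) ∧ L ≤ t n - fs n := fun hn => by
    simpa [hJ, Finset.mem_filter, Finset.mem_range] using hn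
  rcases J.eq_empty_or_nonempty with hJe | hJne
  · rw [hJe, Finset.card_empty, Nat.cast_zero]
    linarith
  -- the first and the last index in `J`
  obtain ⟨hn₀c, ⟨hn₀t₁, -⟩, -⟩ := hmemJ (J.min'_mem hJne)
  obtain ⟨hmc, ⟨-, hmt₂⟩, -⟩ := hmemJ (J.max'_mem hJne)
  have hlt_of : ∀ {n : ℕ}, n ∈ J.erase (J.min' hJne) → J.min' hJne < n ∧ n ∈ J := fun {n} hn => by
    obtain ⟨hne, hnJ⟩ := Finset.mem_erase.1 hn
    exact ⟨lt_of_le_of_ne (J.min'_le n hnJ) (Ne.symm hne), hnJ⟩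
  -- (#J - 1) · L ≤ Σ_{J ∖ {min}} gaps ≤ Σ_{(min, max]} gaps = t max - t min ≤ t₂ - t₁ ≤ T
  have hkey : ((J.erase (J.min' hJne)).card : ℝ) * L ≤ T :=
    calc ((J.erase (J.min' hJne)).card : ℝ) * L = ∑ _n ∈ J.erase (J.min' hJne), L := by
          rw [Finset.sum_const, nsmul_eq_mul]
      _ ≤ ∑ n ∈ J.erase (J.min' hJne), (t n - t (n - 1)) := by
          refine Finset.sum_le_sum fun n hn => ?_
          obtain ⟨hn₀n, hnJ⟩ := hlt_of hn
          obtain ⟨hnc, -, hnL⟩ := hmemJ hnJ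
          have h1 : 1 ≤ n := Nat.succ_le_of_lt (lt_of_le_of_lt (Nat.zero_le _) hn₀n)
          have := hfs n h1 hnc
          linarith
      _ ≤ ∑ n ∈ Finset.Ioc (J.min' hJne) (J.max' hJne), (t n - t (n - 1)) := by
          refine Finset.sum_le_sum_of_subset_of_nonneg (fun n hn => ?_) (fun n hn _ => ?_)
          · obtain ⟨hn₀n, hnJ⟩ := hlt_of hn
            exact Finset.mem_Ioc.2 ⟨hn₀n, J.le_max' n hnJ⟩
          · obtain ⟨hn₀n, hnm⟩ := Finset.mem_Ioc.1 hn
            have hnc : n < c := lt_of_le_of_lt hnm hmc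
            have h1 : n - 1 < n := Nat.sub_lt (lt_of_le_of_lt (Nat.zero_le _) hn₀n) Nat.one_pos
            have := hmono (lt_trans h1 hnc) hnc h1
            linarith
      _ = t (J.max' hJne) - t (J.min' hJne) :=
          sum_Ioc_sub_pred_eq t (J.min'_le _ (J.max'_mem hJne))
      _ ≤ T := by linarith
  -- hence #J - 1 ≤ A
  have hcard : ((J.erase (J.min' hJne)).card : ℝ) ≤ A := by
    rw [hL, mul_div_assoc', div_le_iff₀ hA, mul_comm T A] at hkey
    exact le_of_mul_le_mul_right hkey hT
  have hJcard : (J.card : ℝ) = ((J.erase (J.min' hJne)).card : ℝ) + 1 := by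
    rw [← Finset.card_erase_add_one (J.min'_mem hJne)]
    push_cast
    ring
  linarith

/-! ## The registered stub -/

/-- **STUB G1 `stub_cutCount` — AT MOST `A + 1` LONG-FLIGHT COLLISIONS PER SPHERE PER KINETIC WINDOW
(registered sub-goal of the glue T′ of the line `Sketch`; combinatorial).** On the good set, for a window
`(t₁, t₂]` of length `≤ t_N`: the collision times of `i` in `(0, τ]` are enumerated increasingly by
`n ↦ t_{i,n}` (`transferEnum`), the flight of the `n`-th ends at `t_{i,n}` and starts at
`s_i = flightStart … 0 i t_{i,n} ≥ t_{i,n-1}` (`le_csSup`), so long flights (`≥ t_N/A`) of consecutive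
windowed collisions tile disjoint sub-intervals of the window: `(#long − 1)·t_N/A ≤ t₂ − t₁ ≤ t_N`.
[folklore] -/
theorem stub_cutCount :
    ∀ (σ : ℝ) (N : ℕ) (Φ : Flow σ N) (τ r A t₁ t₂ : ℝ), 0 < A → t₂ ≤ t₁ + tN N →
    ∀ z : Phase N, z ∈ Φ.good → ∀ i : Fin (N + 1),
    ∑ n ∈ Finset.range (cnt Φ τ z i),
        ((if t₁ < Φ.nthCollisionTimeOf i n z ∧ Φ.nthCollisionTimeOf i n z ≤ t₂ then (1 : ℝ) else 0) *
          (if tN N / A ≤ (past Φ r z i n).2.2.2 - (past Φ r z i n).2.1 then (1 : ℝ) else 0)) ≤ A + 1 := by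
  intro σ N Φ τ r A t₁ t₂ hA ht₂ z hz i
  -- the collision times of `i` along the (good) orbit of `z`
  set S : Set ℝ := collisionTimesOf (Torus.geometry (Fin 3)) (hsDiameter σ N) (fun s => Φ.flow s z) i
    with hS
  have htraj := Φ.isTrajectory z hz
  -- on the good set the typed past carries the collision time and the flight start of `i`
  have hpast : ∀ n : ℕ, (past Φ r z i n).2.2.2 - (past Φ r z i n).2.1 =
      Φ.nthCollisionTimeOf i n z -
        flightStart (Torus.geometry (Fin 3)) (hsDiameter σ N) (fun s => Φ.flow s z) 0 i
          (Φ.nthCollisionTimeOf i n z) := fun n => by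
    simp [past, hz]
  simp_rw [hpast]
  -- the enumeration is strictly increasing below `cnt`
  have hmono : ∀ ⦃a b : ℕ⦄, a < cnt Φ τ z i → b < cnt Φ τ z i → a < b →
      Φ.nthCollisionTimeOf i a z < Φ.nthCollisionTimeOf i b z := fun a b ha hb hab =>
    strictMonoOn_nthTimeAfter_of_ncard (S := S) (a := 0) (b := τ) ha hb hab
  -- the flight ending at the `n`-th collision starts no earlier than the `(n-1)`-st collision
  have hfs : ∀ n : ℕ, 1 ≤ n → n < cnt Φ τ z i →
      Φ.nthCollisionTimeOf i (n - 1) z ≤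
        flightStart (Torus.geometry (Fin 3)) (hsDiameter σ N) (fun s => Φ.flow s z) 0 i
          (Φ.nthCollisionTimeOf i n z) := by
    intro n h1 hn
    have hn' : n - 1 < cnt Φ τ z i := lt_of_lt_of_le (Nat.sub_lt h1 Nat.one_pos) hn.le
    have hmem : nthTimeAfter S 0 (n - 1) ∈ S ∩ Ioc 0 τ :=
      nthTimeAfter_mem_of_lt_ncard (S := S) (a := 0) (b := τ) hn'
    have hlt : Φ.nthCollisionTimeOf i (n - 1) z < Φ.nthCollisionTimeOf i n z :=
      hmono hn' hn (Nat.sub_lt h1 Nat.one_pos)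
    exact le_flightStart_of_mem (htraj.finite_collisionTimesOf_inter_Ioo i 0 _) hmem.1 hmem.2.1 hlt
  exact sum_indicator_longFlight_le (t := fun n => Φ.nthCollisionTimeOf i n z)
    (fs := fun n => flightStart (Torus.geometry (Fin 3)) (hsDiameter σ N) (fun s => Φ.flow s z) 0 i
      (Φ.nthCollisionTimeOf i n z)) hA (tN_pos N) hmono hfs ht₂

end Summit.AtomisticToContinuum.HydrodynamicLimit.Theorems.KickFairRelEquilibriumMesoLine

end
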